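import Summits.QuantumAdvantage.QuantumAdvantage.Theorems.CubicForrelationSignedExactSliceIsLiftDefs
import Literature.Computability.QuantumComplexity.BQPMajorityAmplification

/-!
# Stub `stub_A` of line `Sketch` (crux K2 `SignedExactSliceIsLift`, stmt-QuantumAdvantage-14830)

EXACT AND-POWERING of a uniform quantum circuit family: for every polynomial-time uniform, oracle-free
Clifford+T family `F` and every `K ≥ 1` there is a polynomial-time uniform, oracle-free family `F'` whose
acceptance probability is EXACTLY `(F.acceptProbOn 0 x) ^ K` on every input `x` — run `K` parallel copies of `F`
(the `K`-copy family `PostBQPAmp.family` of `PostBQPAmplification.lean`) and accept iff ALL `K` answer positions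
of the measured string read *accept* (the classical polynomial-time AND read-out
`PostBQPAmp.thrF (posPoly P) K K`, the threshold-`K` instance of the bricks of `BQPMajorityAmplification.lean`,
applied by the classical wrap `CWrap.family` of `CWrapAssembly.lean`). The proof re-runs
`Literature.Computability.QuantumComplexity.exists_majority_amplified` with the Chebyshev estimate replaced by
the exact product law of the Born weights of the blocks (`sum_normSq_prodState_mul`, one-block marginal
`PostBQPAmp.sum_filter_blockState_wire0`): the `K`-copy family followed by the AND read-out says *accept* with
probability exactly `acc ^ K` and *reject* with probability exactly `1 - acc ^ K` (`StubA.kernelProb_andF_true`,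
`StubA.kernelProb_andF_false`); the wrap transports both as lower bounds (`CWrap.kernelProb_family_ge`,
`StubA.kernelProb_andF_le_wrap`), and since the two prefix events are disjoint of total mass `≤ 1`
(`kernelProb_add_kernelProb_le_one`) the acceptance probability of `F'` is squeezed to `acc ^ K`
[cite: Watrous2009, §IV Prop. 3] [cite: BennettBernsteinBrassardVazirani1997, Thm. 4.13 (proof, product form)].
-/

set_option linter.dupNamespace false -- D-0017: single-problem summit ⇒ `QuantumAdvantage.QuantumAdvantage` by design

noncomputable section

namespace Summit.QuantumAdvantage.QuantumAdvantage.Theorems.SignedExactSliceIsLift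

open _root_.Computability Literature.Computability.Complexity Literature.Computability.Cryptography
  Literature.Computability.QuantumComplexity
open Literature.Computability.Complexity.CodeFP (strE unE natE bitE pairE rawE)
open Summit.QuantumAdvantage.QuantumAdvantage.Theses.CubicForrelation (NearExactIsExact SignedExactSliceIsLift)

namespace StubA

open PostBQPAmp Finset

variable (P : PostBQPAmp.Params)

/-! ### The AND read-out: all `K` answer positions read *accept*

The read-out of the `K`-copy family `PostBQPAmp.family P` is the threshold-`K` instance
`thrF (posPoly P) P.K P.K` of `PostBQPAmp.thrF` ("at least `K`, hence all, of the `K` answer positions read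
*accept*", i.e. `0`, the answers being negated in the measured string), in `FP` by `PostBQPAmp.thrF_mem_FP`;
it is written out verbatim below (no new definition). -/

/-- Semantics of the AND read-out `thrF (posPoly P) K K` on a pair whose data covers the answer positions:
`[K ≤ #accepting copies]`. -/
theorem andF_boolPair (x y : List Bool) (h : ∀ j < P.K, blk P x.length j 0 < y.length) :
    thrF (posPoly P) P.K P.K (boolPair x y) = [decide (P.K ≤ accCount P x y)] := by
  unfold accCount
  rw [thrF_boolPair (posPoly P) x y _ _ (fun i hi => by rw [eval_posPoly]; exact h i hi), cntZero,
    PostBPPHash.card_filter_fin P.K (fun j => y.getD (blk P x.length j 0) false = false)]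
  simp only [eval_posPoly]

variable {P}

/-- Counting: `K ≤ #{j : Fin K | p j}` iff every `j` satisfies `p`. -/
theorem le_card_filter_univ_iff {K : ℕ} (p : Fin K → Prop) [DecidablePred p] :
    K ≤ (univ.filter p).card ↔ ∀ j, p j := by
  constructor
  · intro h j
    have hle : (univ.filter p).card ≤ K := by
      simpa only [card_univ, Fintype.card_fin] using card_filter_le (univ : Finset (Fin K)) p
    have huniv : univ.filter p = (univ : Finset (Fin K)) :=
      eq_univ_of_card _ (by rw [Fintype.card_fin]; omega)
    exact (mem_filter.1 (huniv ▸ mem_univ j)).2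
  · intro h
    rw [filter_true_of_mem (fun j _ => h j), card_univ, Fintype.card_fin]

/-- **The AND event read off the register**: after stage 2, the measured string lies in the event
"the AND read-out answers `c`" iff `c = [every answer wire held 1 before stage 2]`. -/
theorem mem_andF_event_iff (x : List Bool) (z : QReg (x.length + anc P x.length)) (c : Bool) :
    List.ofFn (perm2 P x.length z) ∈ {y | thrF (posPoly P) P.K P.K (boolPair x y) = [c]} ↔
      decide (∀ j : Fin P.K, z (ansW x.length j) = true) = c := by
  rw [Set.mem_setOf_eq, andF_boolPair P x _ (fun j hj => by
    rw [List.length_ofFn]; exact blk_fits hj (b_pos P x.length)), accCount_ofFn_perm2]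
  simp only [List.cons.injEq, and_true]
  rw [Bool.decide_congr (le_card_filter_univ_iff (fun j : Fin P.K => z (ansW x.length j) = true))]

/-! ### The exact product law of the `K`-copy kernel -/

/-- Total product weight `1` (every block state is a unit vector). -/
theorem sum_prod_normSq_blockState (x : List Bool) :
    (∑ y : Fin P.K → QReg (b P x.length), ∏ j, ‖blockState P x (y j)‖ ^ 2) = 1 := by
  rw [← Fintype.prod_sum (fun (_ : Fin P.K) (v : QReg (b P x.length)) => ‖blockState P x v‖ ^ 2)]
  simp only [sum_normSq_blockState, prod_const_one]

/-- **The product law**: the product weight of "every answer wire reads `1`" is `acc ^ K`, the `K`-th power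
of the one-block marginal `PostBQPAmp.sum_filter_blockState_wire0`. -/
theorem sum_prod_normSq_blockState_mul_indicator (x : List Bool) :
    (∑ y : Fin P.K → QReg (b P x.length), (∏ j, ‖blockState P x (y j)‖ ^ 2) *
        (if ∀ j, y j ⟨0, b_pos P x.length⟩ = true then (1 : ℝ) else 0)) = P.F.acceptProbOn 0 x ^ P.K := by
  classical
  have e : ∀ y : Fin P.K → QReg (b P x.length), (∏ j, ‖blockState P x (y j)‖ ^ 2) *
      (if ∀ j, y j ⟨0, b_pos P x.length⟩ = true then (1 : ℝ) else 0) =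
        ∏ j, (if (y j) ⟨0, b_pos P x.length⟩ = true then ‖blockState P x (y j)‖ ^ 2 else 0) := by
    intro y
    by_cases h : ∀ j, y j ⟨0, b_pos P x.length⟩ = true
    · rw [if_pos h, mul_one]
      exact prod_congr rfl fun j _ => by rw [if_pos (h j)]
    · rw [if_neg h, mul_zero]
      obtain ⟨j, hj⟩ := not_forall.1 h
      exact (prod_eq_zero (mem_univ j) (by rw [if_neg hj])).symm
  simp only [e]
  rw [← Fintype.prod_sum (fun (_ : Fin P.K) (v : QReg (b P x.length)) =>
      if v ⟨0, b_pos P x.length⟩ = true then ‖blockState P x v‖ ^ 2 else 0),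
    prod_const, card_univ, Fintype.card_fin, ← sum_filter, sum_filter_blockState_wire0]

/-- **The `K`-copy family followed by the AND read-out says *accept* with probability exactly `acc ^ K`.** -/
theorem kernelProb_andF_true (x : List Bool) :
    (family P).kernelProb 0 x {y | thrF (posPoly P) P.K P.K (boolPair x y) = [true]} =
      P.F.acceptProbOn 0 x ^ P.K := by
  classical
  rw [kernelProb_family_eq, ← sum_prod_normSq_blockState_mul_indicator x,
    ← sum_normSq_prodState_mul blockDisjoint (fun _ => blockState P x) (W1 P x)
      (fun y => if ∀ j, y j ⟨0, b_pos P x.length⟩ = true then (1 : ℝ) else 0)]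
  refine sum_congr rfl fun z _ => ?_
  simp only [mem_andF_event_iff, decide_eq_true_eq, Function.comp_apply, blockEmb_zero]
  split_ifs <;> simp

/-- **The `K`-copy family followed by the AND read-out says *reject* with probability exactly `1 - acc ^ K`.** -/
theorem kernelProb_andF_false (x : List Bool) :
    (family P).kernelProb 0 x {y | thrF (posPoly P) P.K P.K (boolPair x y) = [false]} =
      1 - P.F.acceptProbOn 0 x ^ P.K := by
  classical
  have e : ∀ y : Fin P.K → QReg (b P x.length), (∏ j, ‖blockState P x (y j)‖ ^ 2) *
      (1 - if ∀ j, y j ⟨0, b_pos P x.length⟩ = true then (1 : ℝ) else 0) =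
        (∏ j, ‖blockState P x (y j)‖ ^ 2) - (∏ j, ‖blockState P x (y j)‖ ^ 2) *
          (if ∀ j, y j ⟨0, b_pos P x.length⟩ = true then (1 : ℝ) else 0) := fun y => by ring
  calc (family P).kernelProb 0 x {y | thrF (posPoly P) P.K P.K (boolPair x y) = [false]}
      = ∑ z : QReg (x.length + anc P x.length),
          ‖prodState (blockEmb P x.length) (fun _ => blockState P x) (W1 P x) z‖ ^ 2 *
            (1 - if ∀ j, (z ∘ blockEmb P x.length j) ⟨0, b_pos P x.length⟩ = true then (1 : ℝ) else 0) := by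
        rw [kernelProb_family_eq]
        refine sum_congr rfl fun z _ => ?_
        simp only [mem_andF_event_iff, decide_eq_false_iff_not, Function.comp_apply, blockEmb_zero]
        split_ifs <;> simp
    _ = ∑ y : Fin P.K → QReg (b P x.length), (∏ j, ‖blockState P x (y j)‖ ^ 2) *
          (1 - if ∀ j, y j ⟨0, b_pos P x.length⟩ = true then (1 : ℝ) else 0) :=
        sum_normSq_prodState_mul blockDisjoint (fun _ => blockState P x) (W1 P x)
          (fun y => 1 - if ∀ j, y j ⟨0, b_pos P x.length⟩ = true then (1 : ℝ) else 0)
    _ = 1 - P.F.acceptProbOn 0 x ^ P.K := by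
        rw [sum_congr rfl (fun y _ => e y), sum_sub_distrib, sum_prod_normSq_blockState,
          sum_prod_normSq_blockState_mul_indicator]

/-! ### The classical wrap transports the two AND events -/

/-- **The wrap transports the AND events**: the wrapped family (identity pre-processing, the AND read-out as
post-processing, `CWrap.family`) writes `c` first with at least the probability that the AND read-out of the
`K`-copy family answers `c` (`CWrap.kernelProb_family_ge` and monotonicity). -/
theorem kernelProb_andF_le_wrap (Q : CWrap.Params) (hQh : Q.h = id)
    (hQg : Q.g = thrF (posPoly P) P.K P.K) (hQF : Q.F = family P) (x : List Bool) (c : Bool) :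
    (family P).kernelProb 0 x {y | thrF (posPoly P) P.K P.K (boolPair x y) = [c]} ≤
      (CWrap.family Q).kernelProb 0 x {z | [c] <+: z} := by
  have hker := CWrap.kernelProb_family_ge Q x
    (fun _ => {y | thrF (posPoly P) P.K P.K (boolPair x y) = [c]})
  rw [hQh, hQg, hQF] at hker
  refine hker.trans ((CWrap.family Q).kernelProb_mono 0 x ?_)
  rintro z ⟨y, hy, hz⟩
  rw [Set.mem_setOf_eq] at hy
  rwa [hy] at hz

end StubA

/-- **Exact AND-powering of a uniform quantum circuit family** (Watrous 2009, §IV Prop. 3; Bennett–Bernstein–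
Brassard–Vazirani 1997, Thm. 4.13 in product form): for every polynomial-time uniform, oracle-free Clifford+T
family `F` and every `K ≥ 1` there is a polynomial-time uniform, oracle-free family — `K` parallel copies of `F`
followed by the classical read-out "all `K` copies accept" — whose acceptance probability on every input `x` is
exactly `(F.acceptProbOn 0 x) ^ K`. -/
theorem stub_A : ∀ (F : QCircuitFamily cliffordT), F.IsOracleFree → F.IsUniform → ∀ K : ℕ, 0 < K →
    ∃ F' : QCircuitFamily cliffordT, F'.IsOracleFree ∧ F'.IsUniform ∧
      ∀ x : List Bool, F'.acceptProbOn 0 x = F.acceptProbOn 0 x ^ K := by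
  intro F hF hU K hK
  obtain ⟨pF, hpF⟩ := QCircuitFamily.IsUniform.isPolySize' hU
  let P₀ : PostBQPAmp.Params := ⟨F, pF, fun n => (hpF n).2, K, hK⟩
  have hRfree : (PostBQPAmp.family P₀).IsOracleFree := PostBQPAmp.family_isOracleFree P₀ hF
  have hRU : (PostBQPAmp.family P₀).IsUniform := PostBQPAmp.family_isUniform P₀ hU
  obtain ⟨P, hPh, hPg, hPF⟩ :=
    CWrap.exists_params (PolyTimeComputable.id _) (PostBQPAmp.thrF_mem_FP (PostBQPAmp.posPoly P₀) P₀.K P₀.K) hRU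
  refine ⟨CWrap.family P, CWrap.family_isOracleFree P (hPF ▸ hRfree), CWrap.family_isUniform P (hPF ▸ hRU),
    fun x => le_antisymm ?_ ?_⟩
  · -- upper bound: the wrapped family writes `false` first with probability `≥ 1 - acc ^ K`
    have h1 := StubA.kernelProb_andF_le_wrap (P := P₀) P hPh hPg hPF x false
    rw [StubA.kernelProb_andF_false (P := P₀) x] at h1
    have h2 := kernelProb_add_kernelProb_le_one (CWrap.family P) 0 x disjoint_prefix_true_false
    rw [kernelProb_prefix_true_eq_acceptProbOn] at h2
    change (CWrap.family P).acceptProbOn 0 x ≤ P₀.F.acceptProbOn 0 x ^ P₀.K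
    linarith
  · -- lower bound: the wrapped family writes `true` first with probability `≥ acc ^ K`
    have h1 := StubA.kernelProb_andF_le_wrap (P := P₀) P hPh hPg hPF x true
    rw [StubA.kernelProb_andF_true (P := P₀) x] at h1
    rw [← kernelProb_prefix_true_eq_acceptProbOn (CWrap.family P)]
    exact h1

end Summit.QuantumAdvantage.QuantumAdvantage.Theorems.SignedExactSliceIsLift

end
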